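import Mathlib
import Summits.Ventures.PercRepro2.HCov
import Summits.Ventures.PercRepro2.RootLeafUHalf
import Summits.Ventures.PercRepro2.RootLeafUOu
import Summits.Ventures.PercRepro2.RootLeafUClaimI
import Summits.Ventures.PercRepro2.RootLeafUKMaster
import Summits.Ventures.PercRepro2.RootLeafUMasterIdentity
import Summits.Ventures.PercRepro2.RootLeafULSide

/-!
# The `T`-association class of the `o ∈ L` half (blind cell PercRepro2, p4 g28; S3 (G4-u) item (ap),
proofs/P4-G28-TPRIME.md §7)

Vocabulary of RootLeafULSide (the mirror of the K side): `R = PD ⊔ T = {u ↮ a₂, u ↮ c}`, `W = D + t`,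
`oL = {u ↔ o}`, `bL = {u ↔ b}`, `(OU) = T2oL(o := u) = A·D + 2α·t + 2β·P(T,bL) − 2β·P(R,bK)` (`0 ≤ (OU)`:
`T2oL_root_nonneg` through `LMaster.OU_eq`), `δ = t·P(PD,oL) − D·P(T,oL) ≥ 0` (`ToL_mul_D_le`),
`(b)_L = W·P(T,oL,bL) − P(R,oL)·P(T,bL)`, `K3L = P(R,oL)·(OU) + (κ−α)·δ + 2β·(b)_L`
(`0 ≤ K3L → 0 ≤ T2oL`: `LSide.T2oL_nonneg_of_K3L`).

* **`Theta_nonneg`**: `0 ≤ Θ_L := t·P(R,oL)·(OU) + δ·[(κ−α)·t − 2β·P(T,bL)]` for EVERY instance — the mirror of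
  claim (i′) does NOT hold by itself (`(κ−α)·t ≥ 2β·P(T,bL)` fails, e.g. for `b` pendant at `u` when `t′ < d0·Z`),
  but with the `(OU)`-term it does: if the bracket `B_L := (κ−α)·t − 2β·P(T,bL)` is `≥ 0` every term is nonnegative;
  if `B_L < 0`, then `δ ≤ t·P(R,oL)` gives `Θ_L ≥ t·P(R,oL)·((OU) + B_L) = t·P(R,oL)·(W·A − 2β·P(R,bK)) ≥ 0` by
  p4 g24's claim (i) (`LMaster.claim_i`), since `(OU) + B_L = A·D + (α + κ)·t − 2β·P(R,bK)` and `A = κ + α`.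
* **`K3L_nonneg_of_T_assoc`** / **`T2oL_nonneg_of_T_assoc`**: `0 ≤ K3L`, hence `0 ≤ T2oL`, whenever `{o ∈ L}` and
  `{b ∈ L}` are positively associated given `T = {u ↮ a₂, c ∈ K}` (`P(T,oL)·P(T,bL) ≤ t·P(T,oL,bL)`): the association
  gives `t·(b)_L ≥ −P(T,bL)·δ` (the identity `t·(b)_L + P(T,bL)·δ = W·(t·P(T,oL,bL) − P(T,oL)·P(T,bL))`), so
  `t·K3L ≥ Θ_L ≥ 0`; `t = 0` makes every `T`-mass vanish and `K3L = P(R,oL)·(OU) ≥ 0`.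
  The `o ∈ L` half is therefore open exactly on the instances where `o ∈ L` and `b ∈ L` are NEGATIVELY correlated
  given `u ↮ a₂, c ∈ K` — the mirror image of the K side's two-route class (RootLeafUClaimITp).
-/

namespace Summit.Ventures.PercRepro2

open UnionCluster CovForm

namespace RootLeafU

namespace LSide

variable {V : Type*} {E : Type*} [Fintype E] [DecidableEq E] [Fintype V] [DecidableEq V]
  {R : Type*} [Field R] [LinearOrder R] [IsStrictOrderedRing R]

variable (p : E → R) (ends : E → Sym2 V) (o a₂ c b u : V)

/-- `0 ≤ (OU)` in the written-out form (`T2oL_root_nonneg` through `LMaster.OU_eq`). -/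
lemma OU_nonneg (hp : IsProbVec p) : 0 ≤ ((prob p (PDEvent ends u a₂ c) * prob p (connEvent ends a₂ b) + prob p (avoidAll ends a₂ {c}) * gap p ends u a₂ b) + (prob p Set.univ * EQb3 p ends u a₂ c b + prob p Set.univ * PDb p ends u a₂ c b + prob p (connEvent ends a₂ b) * EQ3 p ends u a₂ c + prob p (connEvent ends a₂ b) * prob p (avoidAll ends a₂ {u}) - (prob p Set.univ - prob p (avoidAll ends a₂ {c})) * gap p ends u a₂ b)) * prob p (PDEvent ends u a₂ c) + 2 * (prob p (PDEvent ends u a₂ c) * prob p (connEvent ends a₂ b) + prob p (avoidAll ends a₂ {c}) * gap p ends u a₂ b) * prob p (TEvent ends u a₂ c) + 2 * (prob p Set.univ * prob p (PDEvent ends u a₂ c) + prob p (avoidAll ends a₂ {c}) * prob p (avoidAll ends a₂ {u})) * prob p (TEvent ends u a₂ c ∩ connEvent ends u b) - 2 * (prob p Set.univ * prob p (PDEvent ends u a₂ c) + prob p (avoidAll ends a₂ {c}) * prob p (avoidAll ends a₂ {u})) * (prob p (PDEvent ends u a₂ c ∩ connEvent ends a₂ b) + prob p (TEvent ends u a₂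 c ∩ connEvent ends a₂ b)) := by
  have h := T2oL_root_nonneg p ends a₂ c b u hp
  rw [LMaster.OU_eq] at h
  exact h

omit [Fintype V] [DecidableEq V] in
/-- A `T`-mass vanishes when `t = 0`. -/
lemma prob_T_inter_eq_zero (hp : IsProbVec p) (h : prob p (TEvent ends u a₂ c) = 0) (X : Set (Config E)) :
    prob p (TEvent ends u a₂ c ∩ X) = 0 :=
  le_antisymm (h ▸ prob_mono hp Set.inter_subset_left) (prob_nonneg hp _)

/-- **`0 ≤ Θ_L := t·P(R,oL)·(OU) + δ·[(κ−α)·t − 2β·P(T,bL)]`** on every instance (claim (i) when the bracket is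
negative, the signs of `(OU)`, `δ` otherwise). -/
theorem Theta_nonneg (hp : IsProbVec p) : 0 ≤ prob p (TEvent ends u a₂ c) * (prob p (PDEvent ends u a₂ c ∩ connEvent ends u o) + prob p (TEvent ends u a₂ c ∩ connEvent ends u o)) * (((prob p (PDEvent ends u a₂ c) * prob p (connEvent ends a₂ b) + prob p (avoidAll ends a₂ {c}) * gap p ends u a₂ b) + (prob p Set.univ * EQb3 p ends u a₂ c b + prob p Set.univ * PDb p ends u a₂ c b + prob p (connEvent ends a₂ b) * EQ3 p ends u a₂ c + prob p (connEvent ends a₂ b) * prob p (avoidAll ends a₂ {u}) - (prob p Set.univ - prob p (avoidAll ends a₂ {c})) * gap p ends u a₂ b)) * prob p (PDEvent ends u a₂ c) + 2 * (prob p (PDEvent ends u a₂ c) * prob p (connEvent ends a₂ b) + prob p (avoidAll ends a₂ {c}) * gap p ends u a₂ b) * prob p (TEvent ends u a₂ c) + 2 * (prob p Set.univ * prob p (PDEvent ends u a₂ c) + prob p (avoidAll ends a₂ {c}) * prob p (avoidAll ends a₂ {u})) * prob p (TEvent ends u a₂ c ∩ connEvent ends u b) - 2 * (prob p Set.univ *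 prob p (PDEvent ends u a₂ c) + prob p (avoidAll ends a₂ {c}) * prob p (avoidAll ends a₂ {u})) * (prob p (PDEvent ends u a₂ c ∩ connEvent ends a₂ b) + prob p (TEvent ends u a₂ c ∩ connEvent ends a₂ b))) + (prob p (TEvent ends u a₂ c) * prob p (PDEvent ends u a₂ c ∩ connEvent ends u o) - prob p (PDEvent ends u a₂ c) * prob p (TEvent ends u a₂ c ∩ connEvent ends u o)) * (((prob p Set.univ * EQb3 p ends u a₂ c b + prob p Set.univ * PDb p ends u a₂ c b + prob p (connEvent ends a₂ b) * EQ3 p ends u a₂ c + prob p (connEvent ends a₂ b) * prob p (avoidAll ends a₂ {u}) - (prob p Set.univ - prob p (avoidAll ends a₂ {c})) * gap p ends u a₂ b) - (prob p (PDEvent ends u a₂ c) * prob p (connEvent ends a₂ b) + prob p (avoidAll ends a₂ {c}) * gap p ends u a₂ b)) * prob p (TEvent ends u a₂ c) - 2 * (prob p Set.univ * prob p (PDEvent ends u a₂ c) + prob p (avoidAll ends a₂ {c}) * prob p (avoidAll ends a₂ {u})) * prob p (TEvent ends u a₂ c ∩ connEvent ends u b)) := by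
  classical
  have hOU := OU_nonneg p ends a₂ c b u hp
  have hδ := ToL_mul_D_le p hp ends o u a₂ c
  have hci := LMaster.claim_i p ends a₂ c b u hp
  have n_t := prob_nonneg hp (TEvent ends u a₂ c)
  have n_D := prob_nonneg hp (PDEvent ends u a₂ c)
  have n_PDoL := prob_nonneg hp (PDEvent ends u a₂ c ∩ connEvent ends u o)
  have n_ToL := prob_nonneg hp (TEvent ends u a₂ c ∩ connEvent ends u o)
  have n_RoL : 0 ≤ (prob p (PDEvent ends u a₂ c ∩ connEvent ends u o) + prob p (TEvent ends u a₂ c ∩ connEvent ends u o)) := add_nonneg n_PDoL n_ToL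
  -- `δ ≥ 0` and `δ ≤ t·P(R,oL)`
  have hδ0 : 0 ≤ (prob p (TEvent ends u a₂ c) * prob p (PDEvent ends u a₂ c ∩ connEvent ends u o) - prob p (PDEvent ends u a₂ c) * prob p (TEvent ends u a₂ c ∩ connEvent ends u o)) := by linarith
  have hδle : (prob p (TEvent ends u a₂ c) * prob p (PDEvent ends u a₂ c ∩ connEvent ends u o) - prob p (PDEvent ends u a₂ c) * prob p (TEvent ends u a₂ c ∩ connEvent ends u o)) ≤ prob p (TEvent ends u a₂ c) * (prob p (PDEvent ends u a₂ c ∩ connEvent ends u o) + prob p (TEvent ends u a₂ c ∩ connEvent ends u o)) := by nlinarith [mul_nonneg n_D n_ToL, mul_nonneg n_t n_ToL]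
  rcases le_total 0 (((prob p Set.univ * EQb3 p ends u a₂ c b + prob p Set.univ * PDb p ends u a₂ c b + prob p (connEvent ends a₂ b) * EQ3 p ends u a₂ c + prob p (connEvent ends a₂ b) * prob p (avoidAll ends a₂ {u}) - (prob p Set.univ - prob p (avoidAll ends a₂ {c})) * gap p ends u a₂ b) - (prob p (PDEvent ends u a₂ c) * prob p (connEvent ends a₂ b) + prob p (avoidAll ends a₂ {c}) * gap p ends u a₂ b)) * prob p (TEvent ends u a₂ c) - 2 * (prob p Set.univ * prob p (PDEvent ends u a₂ c) + prob p (avoidAll ends a₂ {c}) * prob p (avoidAll ends a₂ {u})) * prob p (TEvent ends u a₂ c ∩ connEvent ends u b)) with hB | hB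
  · exact add_nonneg (mul_nonneg (mul_nonneg n_t n_RoL) hOU) (mul_nonneg hδ0 hB)
  · -- `Θ_L ≥ t·P(R,oL)·((OU) + B_L) = t·P(R,oL)·(W·A − 2β·P(R,bK)) ≥ 0`
    have h1 : (prob p (TEvent ends u a₂ c) * prob p (PDEvent ends u a₂ c ∩ connEvent ends u o) - prob p (PDEvent ends u a₂ c) * prob p (TEvent ends u a₂ c ∩ connEvent ends u o)) * (((prob p Set.univ * EQb3 p ends u a₂ c b + prob p Set.univ * PDb p ends u a₂ c b + prob p (connEvent ends a₂ b) * EQ3 p ends u a₂ c + prob p (connEvent ends a₂ b) * prob p (avoidAll ends a₂ {u}) - (prob p Set.univ - prob p (avoidAll ends a₂ {c})) * gap p ends u a₂ b) - (prob p (PDEvent ends u a₂ c) * prob p (connEvent ends a₂ b) + prob p (avoidAll ends a₂ {c}) * gap p ends u a₂ b)) * prob p (TEvent ends u a₂ c) - 2 * (prob p Set.univ * prob p (PDEvent ends u a₂ c) + prob p (avoidAll ends a₂ {c}) * prob p (avoidAll ends a₂ {u})) * prob p (TEvent ends u a₂ c ∩ connEvent ends u b)) ≥ (prob p (TEvent ends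 u a₂ c) * (prob p (PDEvent ends u a₂ c ∩ connEvent ends u o) + prob p (TEvent ends u a₂ c ∩ connEvent ends u o))) * (((prob p Set.univ * EQb3 p ends u a₂ c b + prob p Set.univ * PDb p ends u a₂ c b + prob p (connEvent ends a₂ b) * EQ3 p ends u a₂ c + prob p (connEvent ends a₂ b) * prob p (avoidAll ends a₂ {u}) - (prob p Set.univ - prob p (avoidAll ends a₂ {c})) * gap p ends u a₂ b) - (prob p (PDEvent ends u a₂ c) * prob p (connEvent ends a₂ b) + prob p (avoidAll ends a₂ {c}) * gap p ends u a₂ b)) * prob p (TEvent ends u a₂ c) - 2 * (prob p Set.univ * prob p (PDEvent ends u a₂ c) + prob p (avoidAll ends a₂ {c}) * prob p (avoidAll ends a₂ {u})) * prob p (TEvent ends u a₂ c ∩ connEvent ends u b)) :=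
      mul_le_mul_of_nonpos_right hδle hB
    have h2 : 0 ≤ (prob p (TEvent ends u a₂ c) * (prob p (PDEvent ends u a₂ c ∩ connEvent ends u o) + prob p (TEvent ends u a₂ c ∩ connEvent ends u o))) * ((prob p (PDEvent ends u a₂ c) + prob p (TEvent ends u a₂ c)) * ((prob p (PDEvent ends u a₂ c) * prob p (connEvent ends a₂ b) + prob p (avoidAll ends a₂ {c}) * gap p ends u a₂ b) + (prob p Set.univ * EQb3 p ends u a₂ c b + prob p Set.univ * PDb p ends u a₂ c b + prob p (connEvent ends a₂ b) * EQ3 p ends u a₂ c + prob p (connEvent ends a₂ b) * prob p (avoidAll ends a₂ {u}) - (prob p Set.univ - prob p (avoidAll ends a₂ {c})) * gap p ends u a₂ b)) - 2 * (prob p Set.univ * prob p (PDEvent ends u a₂ c) + prob p (avoidAll ends a₂ {c}) * prob p (avoidAll ends a₂ {u})) * (prob p (PDEvent ends u a₂ c ∩ connEvent ends a₂ b) + prob p (TEvent ends u a₂ c ∩ connEvent ends a₂ b))) := mul_nonneg (mul_nonneg n_t n_RoL) hci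
    nlinarith [h1, h2]

set_option maxHeartbeats 400000 in
/-- **The `T`-association class of the `o ∈ L` half**: `0 ≤ K3L` whenever `P(T,oL)·P(T,bL) ≤ t·P(T,oL,bL)`. -/
theorem K3L_nonneg_of_T_assoc (hp : IsProbVec p) (hassoc : prob p (TEvent ends u a₂ c ∩ connEvent ends u o) * prob p (TEvent ends u a₂ c ∩ connEvent ends u b) ≤ prob p (TEvent ends u a₂ c) * prob p (TEvent ends u a₂ c ∩ (connEvent ends u o ∩ connEvent ends u b))) :
    0 ≤ ((prob p (PDEvent ends u a₂ c ∩ connEvent ends u o) + prob p (TEvent ends u a₂ c ∩ connEvent ends u o)) * (((prob p (PDEvent ends u a₂ c) * prob p (connEvent ends a₂ b) + prob p (avoidAll ends a₂ {c}) * gap p ends u a₂ b) + (prob p Set.univ * EQb3 p ends u a₂ c b + prob p Set.univ * PDb p ends u a₂ c b + prob p (connEvent ends a₂ b) * EQ3 p ends u a₂ c + prob p (connEvent ends a₂ b) * prob p (avoidAll ends a₂ {u}) - (prob p Set.univ - prob p (avoidAll ends a₂ {c})) * gap p ends u a₂ b)) * prob p (PDEvent ends u a₂ c) + 2 * (prob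 p (PDEvent ends u a₂ c) * prob p (connEvent ends a₂ b) + prob p (avoidAll ends a₂ {c}) * gap p ends u a₂ b) * prob p (TEvent ends u a₂ c) + 2 * (prob p Set.univ * prob p (PDEvent ends u a₂ c) + prob p (avoidAll ends a₂ {c}) * prob p (avoidAll ends a₂ {u})) * prob p (TEvent ends u a₂ c ∩ connEvent ends u b) - 2 * (prob p Set.univ * prob p (PDEvent ends u a₂ c) + prob p (avoidAll ends a₂ {c}) * prob p (avoidAll ends a₂ {u})) * (prob p (PDEvent ends u a₂ c ∩ connEvent ends a₂ b) + prob p (TEvent ends u a₂ c ∩ connEvent ends a₂ b))) + ((prob p Set.univ * EQb3 p ends u a₂ c b + prob p Set.univ * PDb p ends u a₂ c b + prob p (connEvent ends a₂ b) * EQ3 p ends u a₂ c + prob p (connEvent ends a₂ b) * prob p (avoidAll ends a₂ {u}) - (prob p Set.univ - prob p (avoidAll ends a₂ {c})) * gap p ends u a₂ b) - (prob p (PDEvent ends u a₂ c) * prob p (connEvent ends a₂ b) + prob p (avoidAll ends a₂ {c}) * gap p ends u a₂ b)) * (prob p (TEvent ends u a₂ c) * prob p (PDEvent ends u a₂ c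 ∩ connEvent ends u o) - prob p (PDEvent ends u a₂ c) * prob p (TEvent ends u a₂ c ∩ connEvent ends u o)) + 2 * (prob p Set.univ * prob p (PDEvent ends u a₂ c) + prob p (avoidAll ends a₂ {c}) * prob p (avoidAll ends a₂ {u})) * ((prob p (PDEvent ends u a₂ c) + prob p (TEvent ends u a₂ c)) * prob p (TEvent ends u a₂ c ∩ (connEvent ends u o ∩ connEvent ends u b)) - (prob p (PDEvent ends u a₂ c ∩ connEvent ends u o) + prob p (TEvent ends u a₂ c ∩ connEvent ends u o)) * prob p (TEvent ends u a₂ c ∩ connEvent ends u b))) := by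
  classical
  have hΘ := Theta_nonneg p ends o a₂ c b u hp
  have n_t := prob_nonneg hp (TEvent ends u a₂ c)
  have n_D := prob_nonneg hp (PDEvent ends u a₂ c)
  have n_W : 0 ≤ prob p (PDEvent ends u a₂ c) + prob p (TEvent ends u a₂ c) := add_nonneg n_D n_t
  have hOU := OU_nonneg p ends a₂ c b u hp
  have n_PDoL := prob_nonneg hp (PDEvent ends u a₂ c ∩ connEvent ends u o)
  have n_ToL := prob_nonneg hp (TEvent ends u a₂ c ∩ connEvent ends u o)
  have n_RoL : 0 ≤ (prob p (PDEvent ends u a₂ c ∩ connEvent ends u o) + prob p (TEvent ends u a₂ c ∩ connEvent ends u o)) := add_nonneg n_PDoL n_ToL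
  -- the association gives `W·(t·P(T,oL,bL) − P(T,oL)·P(T,bL)) ≥ 0`
  have hW := mul_nonneg n_W (sub_nonneg.2 hassoc)
  rcases eq_or_lt_of_le n_t with h0 | hpos
  · have e1 := prob_T_inter_eq_zero p ends a₂ c u hp h0.symm (connEvent ends u o)
    have e2 := prob_T_inter_eq_zero p ends a₂ c u hp h0.symm (connEvent ends u b)
    have e3 := prob_T_inter_eq_zero p ends a₂ c u hp h0.symm (connEvent ends u o ∩ connEvent ends u b)
    have e4 := prob_T_inter_eq_zero p ends a₂ c u hp h0.symm (connEvent ends a₂ b)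
    rw [← h0, e1, e2, e3, e4]
    rw [← h0, e2, e4] at hOU
    have n_β : 0 ≤ (prob p Set.univ * prob p (PDEvent ends u a₂ c) + prob p (avoidAll ends a₂ {c}) * prob p (avoidAll ends a₂ {u})) := by
      have := prob_nonneg hp (avoidAll ends a₂ {c}); have := prob_nonneg hp (avoidAll ends a₂ {u})
      rw [prob_univ]; nlinarith
    nlinarith [mul_nonneg n_PDoL hOU]
  · -- `t·K3L ≥ Θ_L`
    have n_β : 0 ≤ (prob p Set.univ * prob p (PDEvent ends u a₂ c) + prob p (avoidAll ends a₂ {c}) * prob p (avoidAll ends a₂ {u})) := by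
      have := prob_nonneg hp (avoidAll ends a₂ {c}); have := prob_nonneg hp (avoidAll ends a₂ {u})
      rw [prob_univ]; nlinarith
    have hβW := mul_nonneg n_β hW
    have key : 0 ≤ prob p (TEvent ends u a₂ c) * (((prob p (PDEvent ends u a₂ c ∩ connEvent ends u o) + prob p (TEvent ends u a₂ c ∩ connEvent ends u o)) * (((prob p (PDEvent ends u a₂ c) * prob p (connEvent ends a₂ b) + prob p (avoidAll ends a₂ {c}) * gap p ends u a₂ b) + (prob p Set.univ * EQb3 p ends u a₂ c b + prob p Set.univ * PDb p ends u a₂ c b + prob p (connEvent ends a₂ b) * EQ3 p ends u a₂ c + prob p (connEvent ends a₂ b) * prob p (avoidAll ends a₂ {u}) - (prob p Set.univ - prob p (avoidAll ends a₂ {c})) * gap p ends u a₂ b)) * prob p (PDEvent ends u a₂ c) + 2 * (prob p (PDEvent ends u a₂ c) * prob p (connEvent ends a₂ b) + prob p (avoidAll ends a₂ {c}) * gap p ends u a₂ b) * prob p (TEvent ends u a₂ c) + 2 * (prob p Set.univ * prob p (PDEvent ends u a₂ c) + prob p (avoidAll ends a₂ {c}) * prob p (avoidAll ends a₂ {u}))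 * prob p (TEvent ends u a₂ c ∩ connEvent ends u b) - 2 * (prob p Set.univ * prob p (PDEvent ends u a₂ c) + prob p (avoidAll ends a₂ {c}) * prob p (avoidAll ends a₂ {u})) * (prob p (PDEvent ends u a₂ c ∩ connEvent ends a₂ b) + prob p (TEvent ends u a₂ c ∩ connEvent ends a₂ b))) + ((prob p Set.univ * EQb3 p ends u a₂ c b + prob p Set.univ * PDb p ends u a₂ c b + prob p (connEvent ends a₂ b) * EQ3 p ends u a₂ c + prob p (connEvent ends a₂ b) * prob p (avoidAll ends a₂ {u}) - (prob p Set.univ - prob p (avoidAll ends a₂ {c})) * gap p ends u a₂ b) - (prob p (PDEvent ends u a₂ c) * prob p (connEvent ends a₂ b) + prob p (avoidAll ends a₂ {c}) * gap p ends u a₂ b)) * (prob p (TEvent ends u a₂ c) * prob p (PDEvent ends u a₂ c ∩ connEvent ends u o) - prob p (PDEvent ends u a₂ c) * prob p (TEvent ends u a₂ c ∩ connEvent ends u o)) + 2 * (prob p Set.univ * prob p (PDEvent ends u a₂ c) + prob p (avoidAll ends a₂ {c}) * prob p (avoidAll ends a₂ {u})) * ((prob p (PDEvent ends u a₂ c)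 + prob p (TEvent ends u a₂ c)) * prob p (TEvent ends u a₂ c ∩ (connEvent ends u o ∩ connEvent ends u b)) - (prob p (PDEvent ends u a₂ c ∩ connEvent ends u o) + prob p (TEvent ends u a₂ c ∩ connEvent ends u o)) * prob p (TEvent ends u a₂ c ∩ connEvent ends u b)))) := by
      nlinarith [hΘ, hβW]
    exact (mul_nonneg_iff_of_pos_left hpos).mp key

/-- **`0 ≤ T2oL` on the `T`-association class.** -/
theorem T2oL_nonneg_of_T_assoc (hp : IsProbVec p) (hassoc : prob p (TEvent ends u a₂ c ∩ connEvent ends u o) * prob p (TEvent ends u a₂ c ∩ connEvent ends u b) ≤ prob p (TEvent ends u a₂ c) * prob p (TEvent ends u a₂ c ∩ (connEvent ends u o ∩ connEvent ends u b))) :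
    0 ≤ T2oL p ends o a₂ c b u :=
  T2oL_nonneg_of_K3L p ends o a₂ c b u hp (K3L_nonneg_of_T_assoc p ends o a₂ c b u hp hassoc)

end LSide

end RootLeafU

end Summit.Ventures.PercRepro2
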